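import Summits.Ventures.PercRepro.S1CFGSix
import Summits.Ventures.PercRepro.S1CFGSimpleFive

/-!
# PercRepro — THE CAPS AT NULLITY `6` ON `14` AND `15` POINTS, BY NUMBER (p1, gen 38)

For p7's regimes with a nullity-`6` contraction at `(13, 10)`: the SIMPLE (no dependent pair) coloop-free matroid of
nullity `6` on `n = 14 / 15` points (rank forms `{X | X ⊆ E ∧ |X| = k ∧ rk X ≤ s}.ncard`):

| `n` | `Q₃² = D₃` | `Q₄²` | `Q₄³ = D₄` | `Q₅²` | `Q₅³` | `Q₆²` | `Q₆³` | `Q₆⁴` |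
|---|---|---|---|---|---|---|---|---|
| 14 | 56 | 56 | 742 | 33 | 705 | 11 | 402 | 2392 |
| 15 | 56 | 56 | 798 | 33 | 761 | 11 | 435 | 3270 |

(`Q₅⁴ = D₅` and `Q₆⁵ = D₆` stay trivial — the engine's bounds exceed `C(n, 5)` / `C(n, 6)` here.) And for an arbitrary loopless
coloop-free matroid of nullity `6` on `n ≥ 13` points the rank-`1` family: `D₂ ≤ 15`, `Q₃¹ ≤ 20`, `Q₄¹ ≤ 15`, `Q₅¹ ≤ 6`, `Q₆¹ ≤ 1`.
Nothing about any cell is claimed. Axioms: standard.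
-/

open scoped Matroid

namespace PercRepro

namespace S1CFG

open Set S1CF

variable {α : Type}

/-- The rank of a nullity-`6` matroid on `n` points is `n − 6`. -/
theorem eRk_ground_toNat_eq_of_six (M : Matroid α) [M.Finite] (hd : M.E.encard = M.eRank + ((6 : ℕ) : ℕ∞)) :
    (M.eRk M.E).toNat = M.E.ncard - 6 := by
  have := ncard_ground_eq_eRk_toNat_add M hd
  omega

/-- `D₂ ≤ 15` at nullity `6` on `n ≥ 13` points. -/
theorem ncard_dep_pairs_le_fifteen_of_six (M : Matroid α) [M.Finite] (hL : ∀ e ∈ M.E, ¬ M.IsLoop e)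
    (hK : ∀ e, ¬ M.IsColoop e) (hd : M.E.encard = M.eRank + ((6 : ℕ) : ℕ∞)) (hn : 13 ≤ M.E.ncard) :
    {P : Set α | P ⊆ M.E ∧ P.ncard = 2 ∧ M.Dep P}.ncard ≤ 15 := by
  have := ncard_dep_pairs_le_choose M hL hK hd (by omega)
  have hc : (6 : ℕ).choose 2 = 15 := by decide
  rw [hc] at this
  exact this

/-- `Q₂¹ ≤ 15` at nullity `6` on `n ≥ 13` points (rank form). -/
theorem ncard_two_eRk_le_one_le_fifteen_of_six (M : Matroid α) [M.Finite] (hL : ∀ e ∈ M.E, ¬ M.IsLoop e)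
    (hK : ∀ e, ¬ M.IsColoop e) (hd : M.E.encard = M.eRank + ((6 : ℕ) : ℕ∞)) (hn : 13 ≤ M.E.ncard) :
    {X : Set α | X ⊆ M.E ∧ X.ncard = 2 ∧ M.eRk X ≤ 1}.ncard ≤ 15 :=
  (Set.ncard_le_ncard (two_eRk_le_one_subset_dep M)
    (M.ground_finite.finite_subsets.subset (fun _ hX => hX.1))).trans
    (ncard_dep_pairs_le_fifteen_of_six M hL hK hd hn)

/-- `Q₃¹ ≤ 20` at nullity `6` on `n ≥ 13` points. -/
theorem ncard_three_eRk_le_one_le_twenty_of_six (M : Matroid α) [M.Finite] (hL : ∀ e ∈ M.E, ¬ M.IsLoop e)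
    (hK : ∀ e, ¬ M.IsColoop e) (hd : M.E.encard = M.eRank + ((6 : ℕ) : ℕ∞)) (hn : 13 ≤ M.E.ncard) :
    {X : Set α | X ⊆ M.E ∧ X.ncard = 3 ∧ M.eRk X ≤ 1}.ncard ≤ 20 := by
  have hr := eRk_ground_toNat_eq_of_six M hd
  have h1 := three_mul_ncard_three_eRk_le_one_le M hL hK hd (by omega)
  have h2 := ncard_two_eRk_le_one_le_fifteen_of_six M hL hK hd hn
  have h3 : (6 - 2) * {X : Set α | X ⊆ M.E ∧ X.ncard = 2 ∧ M.eRk X ≤ 1}.ncard ≤ (6 - 2) * 15 :=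
    Nat.mul_le_mul_left _ h2
  omega

/-- `Q₄¹ ≤ 15` at nullity `6` on `n ≥ 13` points. -/
theorem ncard_four_eRk_le_one_le_fifteen_of_six (M : Matroid α) [M.Finite] (hL : ∀ e ∈ M.E, ¬ M.IsLoop e)
    (hK : ∀ e, ¬ M.IsColoop e) (hd : M.E.encard = M.eRank + ((6 : ℕ) : ℕ∞)) (hn : 13 ≤ M.E.ncard) :
    {X : Set α | X ⊆ M.E ∧ X.ncard = 4 ∧ M.eRk X ≤ 1}.ncard ≤ 15 := by
  have hr := eRk_ground_toNat_eq_of_six M hd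
  have h1 := four_mul_ncard_four_eRk_le_one_le M hL hK hd (by omega)
  have h2 := ncard_three_eRk_le_one_le_twenty_of_six M hL hK hd hn
  have h3 : (6 - 3) * {X : Set α | X ⊆ M.E ∧ X.ncard = 3 ∧ M.eRk X ≤ 1}.ncard ≤ (6 - 3) * 20 :=
    Nat.mul_le_mul_left _ h2
  omega

/-- `Q₅¹ ≤ 6` at nullity `6` on `n ≥ 13` points. -/
theorem ncard_five_eRk_le_one_le_six_of_six (M : Matroid α) [M.Finite] (hL : ∀ e ∈ M.E, ¬ M.IsLoop e)
    (hK : ∀ e, ¬ M.IsColoop e) (hd : M.E.encard = M.eRank + ((6 : ℕ) : ℕ∞)) (hn : 13 ≤ M.E.ncard) :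
    {X : Set α | X ⊆ M.E ∧ X.ncard = 5 ∧ M.eRk X ≤ 1}.ncard ≤ 6 := by
  have hr := eRk_ground_toNat_eq_of_six M hd
  have h1 := five_mul_ncard_five_eRk_le_one_le M hL hK hd (by omega)
  have h2 := ncard_four_eRk_le_one_le_fifteen_of_six M hL hK hd hn
  have h3 : (6 - 4) * {X : Set α | X ⊆ M.E ∧ X.ncard = 4 ∧ M.eRk X ≤ 1}.ncard ≤ (6 - 4) * 15 :=
    Nat.mul_le_mul_left _ h2
  omega

/-- `Q₆¹ ≤ 1` at nullity `6` on `n ≥ 13` points. -/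
theorem ncard_six_eRk_le_one_le_one_of_six (M : Matroid α) [M.Finite] (hL : ∀ e ∈ M.E, ¬ M.IsLoop e)
    (hK : ∀ e, ¬ M.IsColoop e) (hd : M.E.encard = M.eRank + ((6 : ℕ) : ℕ∞)) (hn : 13 ≤ M.E.ncard) :
    {X : Set α | X ⊆ M.E ∧ X.ncard = 6 ∧ M.eRk X ≤ 1}.ncard ≤ 1 := by
  have hr := eRk_ground_toNat_eq_of_six M hd
  have h1 := six_mul_ncard_six_eRk_le_one_le M hL hK hd (by omega)
  have h2 := ncard_five_eRk_le_one_le_six_of_six M hL hK hd hn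
  have h3 : (6 - 5) * {X : Set α | X ⊆ M.E ∧ X.ncard = 5 ∧ M.eRk X ≤ 1}.ncard ≤ (6 - 5) * 6 :=
    Nat.mul_le_mul_left _ h2
  omega

/-- `D₃ ≤ 56` for a simple matroid of nullity `6`. -/
theorem ncard_three_eRk_le_two_le_fiftysix_of_no_dep_pair (M : Matroid α) [M.Finite]
    (hd : M.E.encard = M.eRank + ((6 : ℕ) : ℕ∞))
    (h0 : {P : Set α | P ⊆ M.E ∧ P.ncard = 2 ∧ M.Dep P}.ncard = 0) :
    {X : Set α | X ⊆ M.E ∧ X.ncard = 3 ∧ M.eRk X ≤ 2}.ncard ≤ 56 := by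
  have := ncard_three_eRk_le_two_le_of_no_dep_pair M hd h0
  have hc : (6 + 2 : ℕ).choose 3 = 56 := by decide
  rw [hc] at this
  exact this

/-- `Q₄² ≤ 56` for a simple coloop-free matroid of nullity `6` on `n ≥ 9` points. -/
theorem ncard_four_eRk_le_two_le_fiftysix_of_no_dep_pair (M : Matroid α) [M.Finite] (hK : ∀ e, ¬ M.IsColoop e)
    (hd : M.E.encard = M.eRank + ((6 : ℕ) : ℕ∞))
    (h0 : {P : Set α | P ⊆ M.E ∧ P.ncard = 2 ∧ M.Dep P}.ncard = 0) (hn : 9 ≤ M.E.ncard) :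
    {X : Set α | X ⊆ M.E ∧ X.ncard = 4 ∧ M.eRk X ≤ 2}.ncard ≤ 56 := by
  have hr := eRk_ground_toNat_eq_of_six M hd
  have := four_mul_ncard_four_eRk_le_two_le_of_no_dep_pair M hK hd h0 (by omega)
  have hc : (6 + 2 : ℕ).choose 3 = 56 := by decide
  rw [hc] at this
  omega

/-- `D₄ ≤ 56 · (n − 3) + 126` for a simple matroid of nullity `6`. -/
theorem ncard_four_eRk_le_three_le_of_no_dep_pair_six (M : Matroid α) [M.Finite]
    (hd : M.E.encard = M.eRank + ((6 : ℕ) : ℕ∞))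
    (h0 : {P : Set α | P ⊆ M.E ∧ P.ncard = 2 ∧ M.Dep P}.ncard = 0) :
    {X : Set α | X ⊆ M.E ∧ X.ncard = 4 ∧ M.eRk X ≤ 3}.ncard ≤ (M.E.ncard - 3) * 56 + 126 := by
  have := ncard_four_eRk_le_three_le_of_no_dep_pair M hd h0
  have hc3 : (6 + 2 : ℕ).choose 3 = 56 := by decide
  have hc4 : (6 + 3 : ℕ).choose 4 = 126 := by decide
  rw [hc3, hc4] at this
  exact this

/-- `Q₅² ≤ 33` for a simple coloop-free matroid of nullity `6` on `n ≥ 9` points. -/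
theorem ncard_five_eRk_le_two_le_thirtythree_of_no_dep_pair (M : Matroid α) [M.Finite] (hK : ∀ e, ¬ M.IsColoop e)
    (hd : M.E.encard = M.eRank + ((6 : ℕ) : ℕ∞))
    (h0 : {P : Set α | P ⊆ M.E ∧ P.ncard = 2 ∧ M.Dep P}.ncard = 0) (hn : 9 ≤ M.E.ncard) :
    {X : Set α | X ⊆ M.E ∧ X.ncard = 5 ∧ M.eRk X ≤ 2}.ncard ≤ 33 := by
  have hr := eRk_ground_toNat_eq_of_six M hd
  have h1 := five_mul_ncard_five_eRk_le_two_le_of_no_dep_pair M hK hd h0 (by omega)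
  have h2 := ncard_four_eRk_le_two_le_fiftysix_of_no_dep_pair M hK hd h0 hn
  have h3 : (6 - 3) * {X : Set α | X ⊆ M.E ∧ X.ncard = 4 ∧ M.eRk X ≤ 2}.ncard ≤ (6 - 3) * 56 :=
    Nat.mul_le_mul_left _ h2
  omega

/-- `Q₆² ≤ 11` for a simple coloop-free matroid of nullity `6` on `n ≥ 9` points. -/
theorem ncard_six_eRk_le_two_le_eleven_of_no_dep_pair (M : Matroid α) [M.Finite] (hK : ∀ e, ¬ M.IsColoop e)
    (hd : M.E.encard = M.eRank + ((6 : ℕ) : ℕ∞))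
    (h0 : {P : Set α | P ⊆ M.E ∧ P.ncard = 2 ∧ M.Dep P}.ncard = 0) (hn : 9 ≤ M.E.ncard) :
    {X : Set α | X ⊆ M.E ∧ X.ncard = 6 ∧ M.eRk X ≤ 2}.ncard ≤ 11 := by
  have hr := eRk_ground_toNat_eq_of_six M hd
  have h1 := six_mul_ncard_six_eRk_le_two_le M hK hd (by omega)
  have h2 := ncard_five_eRk_le_two_le_thirtythree_of_no_dep_pair M hK hd h0 hn
  have h51 : {X : Set α | X ⊆ M.E ∧ X.ncard = 5 ∧ M.eRk X ≤ 1}.ncard = 0 := by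
    have hEfin := M.ground_finite
    rw [Set.ncard_eq_zero (hEfin.finite_subsets.subset (fun X hX => hX.1)), Set.eq_empty_iff_forall_notMem]
    rintro X ⟨hXE, hX5, hXr⟩
    have h4 := ncard_four_eRk_le_one_eq_zero_of_no_dep_pair M h0
    rw [Set.ncard_eq_zero (hEfin.finite_subsets.subset (fun X hX => hX.1)), Set.eq_empty_iff_forall_notMem] at h4
    have hXfin : X.Finite := hEfin.subset hXE
    obtain ⟨x, hx⟩ : X.Nonempty := by rw [← Set.ncard_pos hXfin, hX5]; norm_num
    exact h4 (X \ {x}) ⟨sdiff_subset.trans hXE, by rw [Set.ncard_sdiff_singleton_of_mem hx, hX5],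
      (M.eRk_mono sdiff_subset).trans hXr⟩
  have h3 : (6 - 4) * {X : Set α | X ⊆ M.E ∧ X.ncard = 5 ∧ M.eRk X ≤ 2}.ncard ≤ (6 - 4) * 33 :=
    Nat.mul_le_mul_left _ h2
  rw [h51, mul_zero, add_zero] at h1
  omega

/-- `Q₅³ ≤ 705` for a simple coloop-free matroid of nullity `6` on `14` points. -/
theorem ncard_five_eRk_le_three_le_fourteen_of_no_dep_pair_six (M : Matroid α) [M.Finite] (hK : ∀ e, ¬ M.IsColoop e)
    (hd : M.E.encard = M.eRank + ((6 : ℕ) : ℕ∞))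
    (h0 : {P : Set α | P ⊆ M.E ∧ P.ncard = 2 ∧ M.Dep P}.ncard = 0) (hn : M.E.ncard = 14) :
    {X : Set α | X ⊆ M.E ∧ X.ncard = 5 ∧ M.eRk X ≤ 3}.ncard ≤ 705 := by
  have hr := eRk_ground_toNat_eq_of_six M hd
  have h1 := five_mul_ncard_five_eRk_le_three_le M hK hd (by omega)
  have h2 := ncard_four_eRk_le_two_le_fiftysix_of_no_dep_pair M hK hd h0 (by omega)
  have h3 := ncard_four_eRk_le_three_le_of_no_dep_pair_six M hd h0
  rw [hn] at h1 h3
  have h4 : (6 - 2) * {X : Set α | X ⊆ M.E ∧ X.ncard = 4 ∧ M.eRk X ≤ 3}.ncard ≤ (6 - 2) * ((14 - 3) * 56 + 126) :=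
    Nat.mul_le_mul_left _ h3
  have h5 : (14 - 4) * {X : Set α | X ⊆ M.E ∧ X.ncard = 4 ∧ M.eRk X ≤ 2}.ncard ≤ (14 - 4) * 56 :=
    Nat.mul_le_mul_left _ h2
  omega

/-- `Q₆³ ≤ 402` for a simple coloop-free matroid of nullity `6` on `14` points. -/
theorem ncard_six_eRk_le_three_le_fourteen_of_no_dep_pair_six (M : Matroid α) [M.Finite] (hK : ∀ e, ¬ M.IsColoop e)
    (hd : M.E.encard = M.eRank + ((6 : ℕ) : ℕ∞))
    (h0 : {P : Set α | P ⊆ M.E ∧ P.ncard = 2 ∧ M.Dep P}.ncard = 0) (hn : M.E.ncard = 14) :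
    {X : Set α | X ⊆ M.E ∧ X.ncard = 6 ∧ M.eRk X ≤ 3}.ncard ≤ 402 := by
  have hr := eRk_ground_toNat_eq_of_six M hd
  have h1 := six_mul_ncard_six_eRk_le_three_le M hK hd (by omega)
  have h2 := ncard_five_eRk_le_three_le_fourteen_of_no_dep_pair_six M hK hd h0 hn
  have h3 := ncard_five_eRk_le_two_le_thirtythree_of_no_dep_pair M hK hd h0 (by omega)
  rw [hn] at h1
  have h4 : (6 - 3) * {X : Set α | X ⊆ M.E ∧ X.ncard = 5 ∧ M.eRk X ≤ 3}.ncard ≤ (6 - 3) * 705 :=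
    Nat.mul_le_mul_left _ h2
  have h5 : (14 - 5) * {X : Set α | X ⊆ M.E ∧ X.ncard = 5 ∧ M.eRk X ≤ 2}.ncard ≤ (14 - 5) * 33 :=
    Nat.mul_le_mul_left _ h3
  omega

/-- `Q₆⁴ ≤ 2392` for a simple coloop-free matroid of nullity `6` on `14` points. -/
theorem ncard_six_eRk_le_four_le_fourteen_of_no_dep_pair_six (M : Matroid α) [M.Finite] (hK : ∀ e, ¬ M.IsColoop e)
    (hd : M.E.encard = M.eRank + ((6 : ℕ) : ℕ∞))
    (h0 : {P : Set α | P ⊆ M.E ∧ P.ncard = 2 ∧ M.Dep P}.ncard = 0) (hn : M.E.ncard = 14) :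
    {X : Set α | X ⊆ M.E ∧ X.ncard = 6 ∧ M.eRk X ≤ 4}.ncard ≤ 2392 := by
  have hEfin := M.ground_finite
  have hr := eRk_ground_toNat_eq_of_six M hd
  have h1 := six_mul_ncard_six_eRk_le_four_le M hK hd (by omega)
  have h2 := ncard_five_eRk_le_three_le_fourteen_of_no_dep_pair_six M hK hd h0 hn
  have h3 : {X : Set α | X ⊆ M.E ∧ X.ncard = 5 ∧ M.eRk X ≤ 4}.ncard ≤ 2002 := by
    have := Set.ncard_le_ncard (show {X : Set α | X ⊆ M.E ∧ X.ncard = 5 ∧ M.eRk X ≤ 4} ⊆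
        {X : Set α | X ⊆ M.E ∧ X.ncard = 5} from fun X hX => ⟨hX.1, hX.2.1⟩)
      (hEfin.finite_subsets.subset (fun X hX => hX.1))
    rw [ncard_subsets_eq_choose hEfin 5, hn] at this
    exact this.trans (by decide)
  rw [hn] at h1
  have h4 : (6 - 2) * {X : Set α | X ⊆ M.E ∧ X.ncard = 5 ∧ M.eRk X ≤ 4}.ncard ≤ (6 - 2) * 2002 :=
    Nat.mul_le_mul_left _ h3
  have h5 : (14 - 5) * {X : Set α | X ⊆ M.E ∧ X.ncard = 5 ∧ M.eRk X ≤ 3}.ncard ≤ (14 - 5) * 705 :=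
    Nat.mul_le_mul_left _ h2
  omega

/-- `Q₅³ ≤ 761` for a simple coloop-free matroid of nullity `6` on `15` points. -/
theorem ncard_five_eRk_le_three_le_fifteen_of_no_dep_pair_six (M : Matroid α) [M.Finite] (hK : ∀ e, ¬ M.IsColoop e)
    (hd : M.E.encard = M.eRank + ((6 : ℕ) : ℕ∞))
    (h0 : {P : Set α | P ⊆ M.E ∧ P.ncard = 2 ∧ M.Dep P}.ncard = 0) (hn : M.E.ncard = 15) :
    {X : Set α | X ⊆ M.E ∧ X.ncard = 5 ∧ M.eRk X ≤ 3}.ncard ≤ 761 := by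
  have hr := eRk_ground_toNat_eq_of_six M hd
  have h1 := five_mul_ncard_five_eRk_le_three_le M hK hd (by omega)
  have h2 := ncard_four_eRk_le_two_le_fiftysix_of_no_dep_pair M hK hd h0 (by omega)
  have h3 := ncard_four_eRk_le_three_le_of_no_dep_pair_six M hd h0
  rw [hn] at h1 h3
  have h4 : (6 - 2) * {X : Set α | X ⊆ M.E ∧ X.ncard = 4 ∧ M.eRk X ≤ 3}.ncard ≤ (6 - 2) * ((15 - 3) * 56 + 126) :=
    Nat.mul_le_mul_left _ h3
  have h5 : (15 - 4) * {X : Set α | X ⊆ M.E ∧ X.ncard = 4 ∧ M.eRk X ≤ 2}.ncard ≤ (15 - 4) * 56 :=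
    Nat.mul_le_mul_left _ h2
  omega

/-- `Q₆³ ≤ 435` for a simple coloop-free matroid of nullity `6` on `15` points. -/
theorem ncard_six_eRk_le_three_le_fifteen_of_no_dep_pair_six (M : Matroid α) [M.Finite] (hK : ∀ e, ¬ M.IsColoop e)
    (hd : M.E.encard = M.eRank + ((6 : ℕ) : ℕ∞))
    (h0 : {P : Set α | P ⊆ M.E ∧ P.ncard = 2 ∧ M.Dep P}.ncard = 0) (hn : M.E.ncard = 15) :
    {X : Set α | X ⊆ M.E ∧ X.ncard = 6 ∧ M.eRk X ≤ 3}.ncard ≤ 435 := by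
  have hr := eRk_ground_toNat_eq_of_six M hd
  have h1 := six_mul_ncard_six_eRk_le_three_le M hK hd (by omega)
  have h2 := ncard_five_eRk_le_three_le_fifteen_of_no_dep_pair_six M hK hd h0 hn
  have h3 := ncard_five_eRk_le_two_le_thirtythree_of_no_dep_pair M hK hd h0 (by omega)
  rw [hn] at h1
  have h4 : (6 - 3) * {X : Set α | X ⊆ M.E ∧ X.ncard = 5 ∧ M.eRk X ≤ 3}.ncard ≤ (6 - 3) * 761 :=
    Nat.mul_le_mul_left _ h2
  have h5 : (15 - 5) * {X : Set α | X ⊆ M.E ∧ X.ncard = 5 ∧ M.eRk X ≤ 2}.ncard ≤ (15 - 5) * 33 :=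
    Nat.mul_le_mul_left _ h3
  omega

/-- `Q₆⁴ ≤ 3270` for a simple coloop-free matroid of nullity `6` on `15` points. -/
theorem ncard_six_eRk_le_four_le_fifteen_of_no_dep_pair_six (M : Matroid α) [M.Finite] (hK : ∀ e, ¬ M.IsColoop e)
    (hd : M.E.encard = M.eRank + ((6 : ℕ) : ℕ∞))
    (h0 : {P : Set α | P ⊆ M.E ∧ P.ncard = 2 ∧ M.Dep P}.ncard = 0) (hn : M.E.ncard = 15) :
    {X : Set α | X ⊆ M.E ∧ X.ncard = 6 ∧ M.eRk X ≤ 4}.ncard ≤ 3270 := by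
  have hEfin := M.ground_finite
  have hr := eRk_ground_toNat_eq_of_six M hd
  have h1 := six_mul_ncard_six_eRk_le_four_le M hK hd (by omega)
  have h2 := ncard_five_eRk_le_three_le_fifteen_of_no_dep_pair_six M hK hd h0 hn
  have h3 : {X : Set α | X ⊆ M.E ∧ X.ncard = 5 ∧ M.eRk X ≤ 4}.ncard ≤ 3003 := by
    have := Set.ncard_le_ncard (show {X : Set α | X ⊆ M.E ∧ X.ncard = 5 ∧ M.eRk X ≤ 4} ⊆
        {X : Set α | X ⊆ M.E ∧ X.ncard = 5} from fun X hX => ⟨hX.1, hX.2.1⟩)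
      (hEfin.finite_subsets.subset (fun X hX => hX.1))
    rw [ncard_subsets_eq_choose hEfin 5, hn] at this
    exact this.trans (by decide)
  rw [hn] at h1
  have h4 : (6 - 2) * {X : Set α | X ⊆ M.E ∧ X.ncard = 5 ∧ M.eRk X ≤ 4}.ncard ≤ (6 - 2) * 3003 :=
    Nat.mul_le_mul_left _ h3
  have h5 : (15 - 5) * {X : Set α | X ⊆ M.E ∧ X.ncard = 5 ∧ M.eRk X ≤ 3}.ncard ≤ (15 - 5) * 761 :=
    Nat.mul_le_mul_left _ h2
  omega

end S1CFG

end PercRepro
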